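import Summits.Langlands.Langlands.Theses.AbelianSurfaceSerre
import Literature.NumberTheory.DiophantineGeometry.BcgpSerreReductionEndTrivialSurfaces
import HarnessLib

/-!
# `AbelianSurfaceSerre.Assembly` (item stmt-Langlands-18281, assembly, rank 1): its exact logical
# position — `Assembly ↔ BCGPSerreReduction ∨ Langlands` — and the conditional closure by name

The route decl `Summit.Langlands.Langlands.Theses.AbelianSurfaceSerre.Assembly` (rev 2 of the
route, 2026-08-17) is

  `SerreGSp4Surjective → QuadraticImprimitiveSurfaces → SurfaceSectorComplement → Langlands`,

with `SurfaceSectorComplement := EndTrivialSurfacesModular → Langlands`. Its informal text lists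
the support item `BCGPSerreReduction` (`SerreGSp4Surjective → QuadraticImprimitiveSurfaces →
EndTrivialSurfacesModular`, Boxer–Calegari–Gee–Pilloni 2025, arXiv:2502.20645, Lemma 10.4.1 with
Remark 10.4.2, proof p. 146, Theorem 10.2.1) among the hypotheses, but the signature does not
carry it. This module settles, by pure (classical propositional) logic over the route's own
declarations, exactly what the signed statement says:

* `Assembly_of_BCGPSerreReduction` — the one-line derivation from the support item
  (`fun hF h₁ h₂ hJ => hJ (hF h₁ h₂)`), the planner's intended proof;
* `Assembly_iff_not_target_imp` — `Assembly ↔ (K1 → K2 → ¬ Target → Langlands)`;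
* `Assembly_iff_bcgpSerreReduction_or_langlands` — `Assembly ↔ (BCGPSerreReduction ∨ Langlands)`:
  the item is EQUIVALENT to "the support item, or the summit outright"; in particular
  (`Assembly_iff_bcgpSerreReduction_of_not_langlands`) short of a proof of the summit constant
  `Langlands` itself, closing `Assembly` is the same task as closing `BCGPSerreReduction`, which is
  `Iff.rfl` the vended named fact
  `Literature.NumberTheory.DiophantineGeometry.bcgp_serreSurjective_quadraticImprimitive_implies_endTrivialSurfacesModular`
  (accepted `Summit.Langlands.Langlands.Theorems.BCGPSerreReduction.route_iff_bcgp`), i.e. an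
  unconditional proof amounts to formalising BCGP 2021/2025 (higher Hida theory, ordinary `R = T`
  for `GSp₄`, multiplicity one and classicality, Arthur's transfer `GSp₄ ↔ GL₄`) and Faltings;
* `Assembly_of_bcgp` — the CONDITIONAL closure against the route decl by name
  (`conditional-result`), from that named fact.

No new definition, no named-fact hypothesis except in `Assembly_of_bcgp`. This file imports the
Theses file and must not be imported by a module the gate links back into it.

References: G. Boxer, F. Calegari, T. Gee, V. Pilloni, *Modularity theorems for abelian
surfaces*, arXiv:2502.20645, §10.4 (Lemma 10.4.1, Rem. 10.4.2, proof p. 146), §10.2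
(Thm. 10.2.1, Rem. 10.2.2) [BoxerCalegariGeePilloni2025]; T. Gee, ICM 2026 survey,
arXiv:2510.02756, §6.
-/


set_option linter.dupNamespace false -- project-wide option (lakefile weak.linter.dupNamespace); `Summit.Langlands.Langlands` is the mandated namespace

namespace Summit.Langlands.Langlands.Theorems.AbelianSurfaceSerreAssembly

open Summit.Langlands.Langlands.Theses.AbelianSurfaceSerre
open Literature.NumberTheory.DiophantineGeometry

/-- **Assembly from the support item (pure logic).** The printed reduction
`BCGPSerreReduction : SerreGSp4Surjective → QuadraticImprimitiveSurfaces →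
EndTrivialSurfacesModular` (BCGP 2025 Lemma 10.4.1 + Rem. 10.4.2 + Thm. 10.2.1, support item
stmt-Langlands-17768) turns the two cruxes into the Target and the complement crux carries the
Target to the summit: `hJ (hF h₁ h₂)`. This is the planner's one-line proof of the item; it is
unconditional as a theorem but has the support item as antecedent.
[cite: BoxerCalegariGeePilloni2025, Lemma 10.4.1, Rem. 10.4.2, Thm. 10.2.1] -/
theorem Assembly_of_BCGPSerreReduction
    (hF : Summit.Langlands.Langlands.Theses.AbelianSurfaceSerre.BCGPSerreReduction) :
    Summit.Langlands.Langlands.Theses.AbelianSurfaceSerre.Assembly :=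
  fun h₁ h₂ hJ => hJ (hF h₁ h₂)

/-- The summit constant gives the item outright (the trivial disjunct). [folklore] -/
theorem Assembly_of_langlands (hL : _root_.Langlands) :
    Summit.Langlands.Langlands.Theses.AbelianSurfaceSerre.Assembly :=
  fun _ _ _ => hL

/-- **What the signed item says.** Unfolding `SurfaceSectorComplement := EndTrivialSurfacesModular
→ Langlands`, the item `Assembly` is equivalent (classically) to
`SerreGSp4Surjective → QuadraticImprimitiveSurfaces → ¬ EndTrivialSurfacesModular → Langlands`:
given the two cruxes, EITHER the Target holds OR the summit holds. [folklore] -/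
theorem Assembly_iff_not_target_imp :
    Summit.Langlands.Langlands.Theses.AbelianSurfaceSerre.Assembly ↔
      (SerreGSp4Surjective → QuadraticImprimitiveSurfaces → ¬ EndTrivialSurfacesModular →
        _root_.Langlands) := by
  constructor
  · intro h h₁ h₂ hT
    exact h h₁ h₂ fun t => absurd t hT
  · intro h h₁ h₂ hJ
    by_cases hT : EndTrivialSurfacesModular
    · exact hJ hT
    · exact h h₁ h₂ hT

/-- **`Assembly ↔ BCGPSerreReduction ∨ Langlands`.** The signed item is exactly "the support item
(BCGP 2025 Lemma 10.4.1 + Rem. 10.4.2 + Thm. 10.2.1 in consumed form: `K1 → K2 → Target`), or the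
summit constant itself": `→` by cases on `Langlands` (if it fails, `Assembly h₁ h₂` applied to the
then-vacuous complement `fun t => absurd (…) ‹¬Langlands›` forces the Target); `←` by
`Assembly_of_BCGPSerreReduction` / `Assembly_of_langlands`.
[cite: BoxerCalegariGeePilloni2025, Lemma 10.4.1, Rem. 10.4.2, Thm. 10.2.1] -/
theorem Assembly_iff_bcgpSerreReduction_or_langlands :
    Summit.Langlands.Langlands.Theses.AbelianSurfaceSerre.Assembly ↔
      (Summit.Langlands.Langlands.Theses.AbelianSurfaceSerre.BCGPSerreReduction ∨
        _root_.Langlands) := by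
  constructor
  · intro h
    by_cases hL : _root_.Langlands
    · exact Or.inr hL
    · refine Or.inl fun h₁ h₂ => ?_
      by_contra hT
      exact hL (h h₁ h₂ fun t => absurd t hT)
  · rintro (hF | hL)
    · exact Assembly_of_BCGPSerreReduction hF
    · exact Assembly_of_langlands hL

/-- **Short of the summit, the item IS the support item.** If the summit constant `Langlands` is
not (yet) available, `Assembly` is equivalent to `BCGPSerreReduction`, hence (accepted
`BCGPSerreReduction.route_iff_bcgp`, `Iff.rfl`) to the vended named fact
`bcgp_serreSurjective_quadraticImprimitive_implies_endTrivialSurfacesModular`: an unconditional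
proof of the item is a formalisation of BCGP 2021/2025 + Faltings, not route wiring.
[cite: BoxerCalegariGeePilloni2025, Lemma 10.4.1, Rem. 10.4.2, Thm. 10.2.1] -/
theorem Assembly_iff_bcgpSerreReduction_of_not_langlands (hL : ¬ _root_.Langlands) :
    Summit.Langlands.Langlands.Theses.AbelianSurfaceSerre.Assembly ↔
      Summit.Langlands.Langlands.Theses.AbelianSurfaceSerre.BCGPSerreReduction := by
  rw [Assembly_iff_bcgpSerreReduction_or_langlands]
  exact ⟨fun h => h.resolve_right hL, Or.inl⟩

/-- **The item is equivalent to the vended fact OR the summit**, with the support item replaced by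
the Literature named fact it is verbatim (`Iff.rfl` bracket for bracket).
[cite: BoxerCalegariGeePilloni2025, Lemma 10.4.1, Rem. 10.4.2, proof p. 146; Thm. 10.2.1; Def. 1.8.12] -/
theorem Assembly_iff_bcgp_or_langlands :
    Summit.Langlands.Langlands.Theses.AbelianSurfaceSerre.Assembly ↔
      (bcgp_serreSurjective_quadraticImprimitive_implies_endTrivialSurfacesModular ∨
        _root_.Langlands) :=
  Assembly_iff_bcgpSerreReduction_or_langlands

/-- **Conditional closure by name** (`conditional-result`): the named fact
`bcgp_serreSurjective_quadraticImprimitive_implies_endTrivialSurfacesModular` (BCGP 2025,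
Lemma 10.4.1 with Rem. 10.4.2 along its proof p. 146, Thm. 10.2.1, Def. 1.8.12, typed for this
route) gives the route decl `AbelianSurfaceSerre.Assembly`: `hJ (h h₁ h₂)`. The item closes
unconditionally only with a discharge
`bcgp_serreSurjective_quadraticImprimitive_implies_endTrivialSurfacesModular_holds` (or a proof of
the summit), by `Assembly_iff_bcgp_or_langlands`.
[cite: BoxerCalegariGeePilloni2025, Lemma 10.4.1, Rem. 10.4.2, proof p. 146; Thm. 10.2.1; Def. 1.8.12] -/
theorem Assembly_of_bcgp
    (h : bcgp_serreSurjective_quadraticImprimitive_implies_endTrivialSurfacesModular) :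
    Summit.Langlands.Langlands.Theses.AbelianSurfaceSerre.Assembly :=
  fun h₁ h₂ hJ => hJ (h h₁ h₂)

end Summit.Langlands.Langlands.Theorems.AbelianSurfaceSerreAssembly
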